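import Literature.Geometry.Lorentzian.CarterThresholdKernelBound
import Literature.Analysis.ODE.ConjugatePairBound
import Literature.Analysis.ODE.ModulusComparison
import Literature.Analysis.ODE.BarrierBasis
import HarnessLib

/-!
# The threshold-sliver kernel bound of Carter's equation from the barrier data
(namespace `Literature.Geometry.Lorentzian.Kerr`.)

The sliver companion of `CarterThresholdKernelBound.threshold_kernel_le_of_barrier`: Carter's radial
equation `u″ + φu = 0`, `φ = ω² − V∘ρ` (DRSR arXiv:1402.7034 §5.2.3) at `σ := ω − mω₊ ≠ 0`, the
horizon-normalised solution `u_𝓗` (flux `−σ`) and the infinity-normalised one `u_𝓘` (flux `ω ≠ 0`),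
a forbidden interval `{φ ≤ 0} = [b₁, b₂]` with the one-barrier geometry
`s_θ ≤ s_lo < s_mid ≤ β = b₂ − L` (floors `k₀` on `[s_θ, β]`, `k₁` on `[s_lo, s_mid]`, layer
`|q| ≤ K_L²` on `[β, b₂]` with `K_L L ≤ 1`), the κ-free envelope `‖u_𝓘‖ ≤ P_I` beyond `b₂`,
`‖u_𝓘′(b₂)‖ ≤ P_I′`, and the near-horizon growth facts of `CarterSliverNearBarrier`
(`Re(ū_𝓗u_𝓗′) ≥ 0` on `[s₃, b₂]`, `‖u_𝓗 x‖ ≤ 12‖u_𝓗 y‖` for `x ≤ y ∈ [s₃, b₂]`, `‖u_𝓗‖ ≥ 1/4` on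
`[s₃, b₂]`, `s₃ ≤ s_θ`):

* `sliver_far_control` — off the threshold the one-sided pairing fails, but
  `‖u_𝓗 t‖ ≤ ‖u_𝓘 t‖(‖W‖ + √|σω|)/|ω|` (`ConjugatePairBound`) and the growth
  `‖u_𝓗 b₂‖ ≥ cosh(k₁(s_mid − s_lo))/48` (`ModulusComparison` + `BarrierBasis`) give, once
  `96P_A√|σω| ≤ |ω|cosh(k₁(s_mid − s_lo))` (`P_A = (P_I + L P_I′)e`), the Wronskian floor
  `√|σω| ≤ ‖W‖` and hence `‖u_𝓗 t‖ ≤ 2‖u_𝓘 t‖‖W‖/|ω|` for every `t`;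
* `sliver_kernel_le_of_barrier` — with the depth condition
  `8((P_I/L + P_I′)e)² ≤ k₁|ω| sinh(2k₁(s_mid − s_lo))`: for all `x ≤ x′` with `s_θ ≤ x′`,
  `‖u_𝓗(x)‖·‖u_𝓘(x′)‖ ≤ 12·(12·(25/7)(1 + k₀ℓ)/(k₀²ℓ) + 24P_A²/|ω| + 1/(2k₀))·‖W‖`, `ℓ = s_mid − s_lo`
  (`OneBarrierKernelBound.oneBarrier_kernel_le` with `A = 12`, `K_A = 24P_A²/|ω|`).

Near-extremal Kerr programme (crux `KappaExplicitWaveDecay`, BF-stable large-`Λ` kernel bound,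
sliver case); the geometry, the envelope and the depth conditions are discharged in the regime files.

## References
* M. Dafermos, I. Rodnianski, Y. Shlapentokh-Rothman, arXiv:1402.7034 = Ann. of Math. 183 (2016),
  §§5.2.3, 6.3–6.5, 8.7 (key `DafermosRodnianskiShlapentokhrothman2014`).
* P. Hartman, *Ordinary Differential Equations* (SIAM Classics 38, 2002), Ch. XI (key `Hartman2002`).
-/

noncomputable section

open Filter Set Literature.Analysis.ODE
open scoped _root_.Topology _root_.ComplexConjugate

namespace Literature.Geometry.Lorentzian

namespace Kerr

section Sliver

variable {M a ω Λ : ℝ} {m : ℤ} {ρ : ℝ → ℝ} {uH uH₁ uI uI₁ : ℝ → ℂ}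

set_option maxHeartbeats 400000 in
-- one long assembly
/-- **The sliver kernel bound from the barrier data.** See the module docstring for the hypotheses and
the constant. [cite: DafermosRodnianskiShlapentokhrothman2014, §8.7] -/
theorem sliver_kernel_le_of_barrier (hρ : IsTortoiseRadius M a ρ) (hMa : IsSubextremal M a)
    (hσ : ω - m * horizonAngularVelocity M a ≠ 0) (hω : ω ≠ 0)
    (hu : ∀ x, HasDerivAt uH (uH₁ x) x ∧
      HasDerivAt uH₁ (-(((ω ^ 2 - sepPotential M a ω m Λ (ρ x) : ℝ) : ℂ) * uH x)) x)
    (hv : ∀ x, HasDerivAt uI (uI₁ x) x ∧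
      HasDerivAt uI₁ (-(((ω ^ 2 - sepPotential M a ω m Λ (ρ x) : ℝ) : ℂ) * uI x)) x)
    (hHf : ∀ x, (starRingEnd ℂ (uH x) * uH₁ x).im = -(ω - m * horizonAngularVelocity M a))
    (hIf : ∀ x, (starRingEnd ℂ (uI x) * uI₁ x).im = ω)
    {b₁ b₂ : ℝ} (hF : {s | ω ^ 2 - sepPotential M a ω m Λ (ρ s) ≤ 0} = Icc b₁ b₂)
    {s₃ sθ slo smid L k₀ k₁ KL PI PI' : ℝ} (hs₃ : b₁ ≤ s₃) (hs₃θ : s₃ ≤ sθ) (hθlo : sθ ≤ slo)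
    (hlomid : slo < smid) (hmidβ : smid ≤ b₂ - L) (hL : 0 < L)
    (hk₀ : 0 < k₀) (hqk₀ : ∀ s ∈ Icc sθ (b₂ - L), k₀ ^ 2 ≤ sepPotential M a ω m Λ (ρ s) - ω ^ 2)
    (hk₁ : 0 < k₁) (hqk₁ : ∀ s ∈ Icc slo smid, k₁ ^ 2 ≤ sepPotential M a ω m Λ (ρ s) - ω ^ 2)
    (hKL : 0 ≤ KL) (hqL : ∀ s ∈ Icc (b₂ - L) b₂, |sepPotential M a ω m Λ (ρ s) - ω ^ 2| ≤ KL ^ 2)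
    (hKLL : KL * L ≤ 1)
    (hPI : ∀ s, b₂ ≤ s → ‖uI s‖ ≤ PI) (hPI' : ‖uI₁ b₂‖ ≤ PI')
    (hO1 : ∀ x ∈ Icc s₃ b₂, 0 ≤ (starRingEnd ℂ (uH x) * uH₁ x).re)
    (hO2 : ∀ x y, x ≤ y → s₃ ≤ y → y ≤ b₂ → ‖uH x‖ ≤ 12 * ‖uH y‖)
    (hO3 : ∀ y ∈ Icc s₃ b₂, 1 / 4 ≤ ‖uH y‖)
    (hdeep : 8 * ((PI / L + PI') * Real.exp 1) ^ 2 ≤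
      k₁ * |ω| * Real.sinh (2 * (k₁ * (smid - slo))))
    (hdeep2 : 96 * ((PI + L * PI') * Real.exp 1) *
      Real.sqrt |(ω - m * horizonAngularVelocity M a) * ω| ≤ |ω| * Real.cosh (k₁ * (smid - slo)))
    {x x' : ℝ} (hxx' : x ≤ x') (hx' : sθ ≤ x') :
    ‖uH x‖ * ‖uI x'‖ ≤
      12 * (12 * (25 / 7 * ((1 + k₀ * (smid - slo)) / (k₀ ^ 2 * (smid - slo)))) +
          24 * ((PI + L * PI') * Real.exp 1) ^ 2 / |ω| + 1 / (2 * k₀)) *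
        ‖uH x * uI₁ x - uI x * uH₁ x‖ := by
  have hM : 0 < M := hMa.pos
  set σ := ω - m * horizonAngularVelocity M a with hσdef
  set q : ℝ → ℝ := fun s ↦ sepPotential M a ω m Λ (ρ s) - ω ^ 2 with hqdef
  set β := b₂ - L with hβdef
  have hβb₂ : β ≤ b₂ := by rw [hβdef]; linarith
  have hs₃b₂ : s₃ ≤ b₂ := hs₃θ.trans (hθlo.trans (hlomid.le.trans (hmidβ.trans hβb₂)))
  -- the equation in the form `y″ = q y`
  have hu' : ∀ x, HasDerivAt uH (uH₁ x) x ∧ HasDerivAt uH₁ ((q x : ℂ) * uH x) x := fun x ↦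
    ⟨(hu x).1, (hu x).2.congr_deriv (by simp only [hqdef]; push_cast; ring)⟩
  have hv' : ∀ x, HasDerivAt uI (uI₁ x) x ∧ HasDerivAt uI₁ ((q x : ℂ) * uI x) x := fun x ↦
    ⟨(hv x).1, (hv x).2.congr_deriv (by simp only [hqdef]; push_cast; ring)⟩
  have hqc : Continuous q := by
    refine continuous_iff_continuousAt.2 fun s ↦ ?_
    have h := (hρ.hasDerivAt_omega_sq_sub_sepPotential hMa ω m Λ s).continuousAt.neg
    refine h.congr (Eventually.of_forall fun y ↦ ?_)
    simp only [hqdef, Pi.neg_apply]; ring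
  -- the Wronskian is constant
  set W := uH 0 * uI₁ 0 - uI 0 * uH₁ 0 with hWdef
  have hW : ∀ y, uH y * uI₁ y - uI y * uH₁ y = W := fun y ↦ wronskian_eq_of_global_sol hu' hv' y 0
  -- `q ≥ 0` on the forbidden interval
  have hmem : ∀ s, ω ^ 2 - sepPotential M a ω m Λ (ρ s) ≤ 0 ↔ s ∈ Icc b₁ b₂ := fun s ↦ by
    rw [← hF]; rfl
  have hq0 : ∀ s ∈ Icc b₁ b₂, 0 ≤ q s := by
    intro s hs
    have h := (hmem s).2 hs
    show 0 ≤ sepPotential M a ω m Λ (ρ s) - ω ^ 2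
    linarith
  have hne : ∀ s, uH s ≠ 0 := by
    intro s h0
    have := hHf s
    rw [h0, map_zero, zero_mul, Complex.zero_im] at this
    exact hσ (by linarith)
  have hω0 : 0 < |ω| := abs_pos.2 hω
  have hW0 : 0 ≤ ‖W‖ := norm_nonneg _
  -- the last layer `[β, b₂] = [β, β + L]`
  have hPI0 : 0 ≤ PI := (norm_nonneg _).trans (hPI b₂ le_rfl)
  have hPI'0 : 0 ≤ PI' := (norm_nonneg _).trans hPI'
  set PA := (PI + L * PI') * Real.exp 1 with hPA
  set PA' := (PI / L + PI') * Real.exp 1 with hPA'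
  have hPA0 : 0 ≤ PA := by positivity
  have hb₂β : b₂ = β + L := by rw [hβdef]; ring
  have hlayer : ∀ s ∈ Icc β b₂, ‖uI s‖ ≤ PA ∧ ‖uI₁ s‖ ≤ PA' := by
    intro s hs
    have hs' : s ∈ Icc β (β + L) := by rw [← hb₂β]; exact hs
    have hb₂' : b₂ ∈ Icc β (β + L) := by rw [← hb₂β]; exact ⟨hβb₂, le_rfl⟩
    have hqL' : ∀ y ∈ Icc β (β + L), ‖((q y : ℝ) : ℂ)‖ ≤ KL ^ 2 := by
      intro y hy
      rw [← hb₂β] at hy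
      rw [Complex.norm_real, Real.norm_eq_abs]
      exact hqL y hy
    obtain ⟨h1, h2⟩ := norm_le_of_norm_coeff_le_sq hL hKL (fun y _ ↦ hv' y) hqL' hb₂' hs'
    have hmax : max (KL * L) 1 = 1 := max_eq_right hKLL
    have hKLi : KL ≤ L⁻¹ := by rw [inv_eq_one_div, le_div_iff₀ hL]; exact hKLL
    have hmax' : max KL L⁻¹ = L⁻¹ := max_eq_right hKLi
    rw [hmax] at h1 h2
    rw [hmax'] at h2
    have hvb : ‖uI b₂‖ ≤ PI := hPI b₂ le_rfl
    have he : 0 ≤ Real.exp 1 := (Real.exp_pos 1).le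
    constructor
    · refine h1.trans (mul_le_mul_of_nonneg_right ?_ he)
      exact add_le_add hvb (mul_le_mul_of_nonneg_left hPI' hL.le)
    · refine h2.trans (mul_le_mul_of_nonneg_right ?_ he)
      have : L⁻¹ * ‖uI b₂‖ ≤ PI / L := by
        rw [div_eq_inv_mul]; exact mul_le_mul_of_nonneg_left hvb (inv_pos.2 hL).le
      exact add_le_add this hPI'
  have hβmem : β ∈ Icc β b₂ := ⟨le_rfl, hβb₂⟩
  have hP₁ : ‖uI₁ β‖ ≤ PA' := (hlayer β hβmem).2
  have hPIA : PI ≤ PA := by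
    rw [hPA]
    have h1 : PI ≤ PI + L * PI' := le_add_of_nonneg_right (by positivity)
    have h2 : PI + L * PI' ≤ (PI + L * PI') * Real.exp 1 :=
      le_mul_of_one_le_right (by positivity) (by have := Real.add_one_le_exp (1:ℝ); linarith)
    exact h1.trans h2
  have hvenv : ∀ s, β ≤ s → ‖uI s‖ ≤ PA := by
    intro s hs
    rcases le_or_gt s b₂ with h | h
    · exact (hlayer s ⟨hs, h⟩).1
    · exact (hPI s h.le).trans hPIA
  -- growth of `u_𝓗` across `[s_lo, s_mid]`: `‖u_𝓗 b₂‖ ≥ cosh(k₁ℓ)/48`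
  have hslo₃ : s₃ ≤ slo := hs₃θ.trans hθlo
  have hmidb₂ : smid ≤ b₂ := hmidβ.trans hβb₂
  have hgrowth : Real.cosh (k₁ * (smid - slo)) / 48 ≤ ‖uH b₂‖ := by
    have hqI : ∀ y ∈ Icc slo smid, 0 ≤ q y := fun y hy ↦
      hq0 y ⟨hs₃.trans (hslo₃.trans hy.1), hy.2.trans hmidb₂⟩
    obtain ⟨g, g', d, d', hg, -, hg0, hg'0, -, -, hgpos, -, -, -, -, hcosh⟩ :=
      exists_barrierBasis hqc hlomid.le hqI
    have hc := norm_mul_le_norm_of_even (β := smid) (fun y _ ↦ hu' y) (fun y _ ↦ hg y) (fun y _ ↦ hne y)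
      (fun y hy ↦ lt_of_lt_of_le one_pos (hgpos y hy).1) hg0 hg'0
      (hO1 slo ⟨hslo₃, hlomid.le.trans hmidb₂⟩) (right_mem_Icc.2 hlomid.le)
    have hcosh' := (hcosh k₁ hk₁ hqk₁ smid (right_mem_Icc.2 hlomid.le)).1
    have h14 : 1 / 4 ≤ ‖uH slo‖ := hO3 slo ⟨hslo₃, hlomid.le.trans hmidb₂⟩
    have h12 : ‖uH smid‖ ≤ 12 * ‖uH b₂‖ := hO2 smid b₂ hmidb₂ hs₃b₂ le_rfl
    have hch0 : 0 ≤ Real.cosh (k₁ * (smid - slo)) := (Real.cosh_pos _).le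
    calc Real.cosh (k₁ * (smid - slo)) / 48 = 1 / 4 * Real.cosh (k₁ * (smid - slo)) / 12 := by ring
      _ ≤ ‖uH slo‖ * g smid / 12 := by gcongr
      _ ≤ ‖uH smid‖ / 12 := by gcongr
      _ ≤ ‖uH b₂‖ := by linarith
  -- the Wronskian floor and the far control `‖u_𝓗 t‖ ≤ 2‖u_𝓘 t‖‖W‖/|ω|`
  have hpair : ∀ t, ‖uH t‖ ≤ ‖uI t‖ * (‖W‖ + Real.sqrt |σ * ω|) / |ω| := by
    intro t
    have h := norm_le_of_conj_pair (hHf t) (hIf t) hω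
    rw [hW t] at h
    have e : |-σ * ω| = |σ * ω| := by rw [neg_mul, abs_neg]
    rw [e] at h
    exact h
  have hsq0 : 0 ≤ Real.sqrt |σ * ω| := Real.sqrt_nonneg _
  have hWmin : Real.sqrt |σ * ω| ≤ ‖W‖ := by
    -- at `b₂`: `cosh/48 ≤ ‖u_𝓗 b₂‖ ≤ P_A(‖W‖ + √|σω|)/|ω|` and `P_A√|σω|/|ω| ≤ cosh/96`
    have h1 := (hgrowth.trans (hpair b₂))
    have h2 : ‖uI b₂‖ * (‖W‖ + Real.sqrt |σ * ω|) / |ω| ≤ PA * (‖W‖ + Real.sqrt |σ * ω|) / |ω| := by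
      gcongr; exact hvenv b₂ hβb₂
    have h3 := h1.trans h2
    rw [le_div_iff₀ hω0] at h3
    -- `cosh·|ω| ≤ 48 P_A ‖W‖ + 48 P_A √|σω|` and `96 P_A √|σω| ≤ |ω| cosh`
    by_contra hcon
    push Not at hcon
    have h4 : PA * ‖W‖ < PA * Real.sqrt |σ * ω| ∨ PA = 0 := by
      rcases hPA0.eq_or_lt with h | h
      · exact Or.inr h.symm
      · exact Or.inl (mul_lt_mul_of_pos_left hcon h)
    rcases h4 with h4 | h4
    · nlinarith [h3, h4, hdeep2, Real.cosh_pos (k₁ * (smid - slo)), hω0]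
    · rw [h4] at h3 hdeep2
      nlinarith [h3, Real.cosh_pos (k₁ * (smid - slo)), hω0]
  have hfar1 : ∀ t, ‖uH t‖ ≤ ‖uI t‖ * (2 * ‖W‖) / |ω| := by
    intro t
    refine (hpair t).trans ?_
    gcongr
    linarith
  -- `hfar` with `K_A = 24 P_A²/|ω|`
  have hKA : 0 ≤ 24 * PA ^ 2 / |ω| := by positivity
  have hfar : ∀ x x', x ≤ x' → β ≤ x' → ‖uH x‖ * ‖uI x'‖ ≤ 24 * PA ^ 2 / |ω| * ‖W‖ := by
    intro x x' hxx' hx'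
    have hux : ‖uH x‖ ≤ 24 * PA * ‖W‖ / |ω| := by
      rcases le_or_gt x' b₂ with h | h
      · have h1 : ‖uH x‖ ≤ 12 * ‖uH x'‖ := hO2 x x' hxx' (hs₃θ.trans ((by linarith : sθ ≤ β).trans hx')) h
        have h2 : ‖uH x'‖ ≤ PA * (2 * ‖W‖) / |ω| := (hfar1 x').trans (by gcongr; exact hvenv x' hx')
        calc ‖uH x‖ ≤ 12 * (PA * (2 * ‖W‖) / |ω|) := h1.trans (by linarith)
          _ = 24 * PA * ‖W‖ / |ω| := by ring
      · rcases le_or_gt x b₂ with hxb | hxb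
        · have h1 : ‖uH x‖ ≤ 12 * ‖uH b₂‖ := hO2 x b₂ hxb hs₃b₂ le_rfl
          have h2 : ‖uH b₂‖ ≤ PA * (2 * ‖W‖) / |ω| := (hfar1 b₂).trans (by gcongr; exact hvenv b₂ hβb₂)
          calc ‖uH x‖ ≤ 12 * (PA * (2 * ‖W‖) / |ω|) := h1.trans (by linarith)
            _ = 24 * PA * ‖W‖ / |ω| := by ring
        · have h2 : ‖uH x‖ ≤ PA * (2 * ‖W‖) / |ω| :=
            (hfar1 x).trans (by gcongr; exact hvenv x (hβb₂.trans hxb.le))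
          calc ‖uH x‖ ≤ PA * (2 * ‖W‖) / |ω| := h2
            _ ≤ 24 * PA * ‖W‖ / |ω| := by
                rw [div_le_div_iff_of_pos_right hω0]; nlinarith [hPA0, hW0]
    calc ‖uH x‖ * ‖uI x'‖ ≤ 24 * PA * ‖W‖ / |ω| * PA :=
          mul_le_mul hux (hvenv x' hx') (norm_nonneg _) (by positivity)
      _ = 24 * PA ^ 2 / |ω| * ‖W‖ := by ring
  -- the quasi-monotonicity and growth on the collar
  have hmono : ∀ x y, x ≤ y → sθ ≤ y → y ≤ β → ‖uH x‖ ≤ 12 * ‖uH y‖ := fun x y hxy hy hyβ ↦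
    hO2 x y hxy (hs₃θ.trans hy) (hyβ.trans hβb₂)
  have hgrow : ∀ y ∈ Icc sθ slo, 0 ≤ (conj (uH y) * uH₁ y).re := fun y hy ↦
    hO1 y ⟨hs₃θ.trans hy.1, hy.2.trans (hlomid.le.trans hmidb₂)⟩
  -- the generic one-barrier bound
  have key := oneBarrier_kernel_le hqc hu' hv' hW hθlo hlomid hmidβ hk₀ hqk₀ hk₁ hqk₁ (hIf β) hP₁
    hdeep (by norm_num : (1:ℝ) ≤ 12) hmono hgrow hKA hfar hxx' hx'
  rw [← hW x] at key
  exact key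

end Sliver

end Kerr

end Literature.Geometry.Lorentzian

end
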